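import Summits.QuantumFields.YangMills.Theorems.BalabanUVNodesN21CollarEnvelopeOdds
import Summits.QuantumFields.YangMills.Theorems.BalabanUVNodesN21LowCentreNonCollapse

/-!
# N21 (NE7c) · THE DOUBLY-DISCHARGED COLLAR JUNCTION ON THE LOW-CENTRE ROAD: (M1) on the cut law with
# non-collapse FROM a low centre, the odds FROM the collar's letters, and the envelope SPLIT LETTERWISE

R141 (C) seat pub-ymgap-dag-n21-e (g16), node N21 = NE7c (single-run shell-weight bound, NOT PRINTED in [Bałaban
1983–89], NOT proved), strategy s3 ALTERNATIVE CURRENCY, lane K3⁷ `SpineGivenEndpointR13SepCoPH`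
(stmt-QuantumFields-20544, `--kind proof --supports … --as helper`).  Part 38m of this seat's series; successor of
38l `…N21CollarEnvelopeOdds` (p575579); consumes n21-d part 30 `…N21LowCentreNonCollapse` (p575319; mathematics = lens
v28.0 ROW P″, Cards 81 ∕ 83) BY NAME — the corollary offered to n21-d at 38l's close (first refusal declined by
taking ROW P‴).

WHY.  Road II's re-centred END (n21-d part 28, P2 `slotAntiConcentration_restrict_of_recentredDilation`) has four
binders about a measurable centre `m`: non-collapse `hmono`, envelope `henv`, transversality `hRT`, odds `hQ`.  Part 31
(`…N21LowCentreDilation`) discharges `hmono` by a LOW centre for the density `𝟙_{K z}(w)·e^{−φ_z(w)}` and keeps `hQ`;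
38l §3 discharges `hQ` by the collar's per-letter conditional odds and keeps `hmono`.  This file composes the two and
splits `henv` letter by letter (part 30 §C), so that on the low-centre road the END's displayed binders are: the
low-centre inequality `hlow`, radial transversality `hRT`, per-letter image clauses, a core clause, and the
per-coordinate odds `hodds` (species: 38l §2, transported under kept cuts by §1 here).
* §1 KEPT CUTS READING NO COLLAR COORDINATE: `fibreIndicator_eq_setIndicator`, `measurable_fibreIndicator`,
  `withDensity_fibreIndicator_eq_restrict` (`(μ).withDensity (𝟙_K·F) = (μ.withDensity F)|K̂`, part 27
  `restrict_withDensity_eq_indicator` BY NAME), `condOdds_restrict_of_notRead` (38l §1's per-coordinate `hodds`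
  passes from `ν` to `ν|S` for `S` measurable reading no coordinate `i`), `condOdds_keptCuts` (⇒ `hodds` for the
  density `𝟙_{K p.1}(p.2)·F` from `hodds` for `F` when `K̂ = {p | p.2 ∈ K p.1}` reads no coordinate `i`);
* §2 `henv` LETTERWISE: `hcore_of_starConvex` (core fibres star-convex about the centre at shell points ⇒ the core
  clause), `letterImage_abs_mem_Ioo` (part 30 `collarImage_mem_relaxedLetter` BY NAME, `Ioo` letters),
  `letterImage_geCut_mem_Ici` (dropped `≥`-cut), `henv_of_letterwise` (per-letter image clauses + core clause ⇒ P2's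
  `henv` with `Env := (⋂ᵢ {q.2 i ∈ E₁ i}) ∩ ({U<θ} ∩ C⋆)`);
* §3 ★★ `slotAntiConcentration_restrict_of_lowCentre_collar` (P2 with `hmono` from part 30 `hmono_of_lowCentre` AND
  `hQ` from 38l §1, via 38l §3 BY NAME) · ★★★ `slotAntiConcentration_restrict_of_lowCentre_letterwise` (the same
  with `henv` from §2);
* A6 (director-ym STANDING A6 RULE №189 (3)): the ★★★ END APPLIED with EVERY binder discharged in the kernel is
  `…N21CollarJunctionLowCentreSanity.collarJunctionLowCentre_binders_inhabited` (sibling file, 400-line rule: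
  one-point exterior, `ℝ²` block, kept cut `K = {|w₁| < 1}` reading no collar coordinate — §1 exercised —, Gaussian
  `φ`, centre `0`, `U = |w₁|`, `θ = 1`, `ρ = ½`, `κ₀ = 1`, letter `(−1, 1) ⊂ (−7∕6, 7∕6)` on coordinate `0`).

HONEST FRAMING.  [textbook] measure theory + convexity + real arithmetic; 0 def, 0 sorry; the low-centre inequality,
transversality, slopes, shells, thresholds, the centre `m`, the kept cuts and the not-read structure are HYPOTHESES
(part 30's certificate ∕ n21-d parts 19 ∕ 27 ∕ NODE O's term object ∕ lens Cards 80–86's located numbers, none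
asserted); nothing of Bałaban's asserted ([Balaban1989LargeFieldI] p. 176 ∕ p. 193 = the located MECHANISM only);
NE7c NOT PRINTED ∕ NOT proved; N21 NOT discharged; counts unmoved (typed 28∕28 · discharged 5∕27); count-neutral; one
finite 𝕋⁴ at fixed ε — nothing about ℝ⁴ ∕ OS ∕ mass gap ∕ Clay.
-/

set_option autoImplicit false

open MeasureTheory Set Function
open scoped ENNReal

namespace Summit.QuantumFields.YangMills.Theorems.N21CollarJunctionLowCentre

open Literature.MathematicalPhysics.QuantumFieldTheory.Balaban1983to89.T4ShellMeasure (SlotAntiConcentration)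
open Summit.QuantumFields.YangMills.Theorems.N21RecentredDilation (restrict_withDensity_eq_indicator)
open Summit.QuantumFields.YangMills.Theorems.N21CollarEnvelopeOdds
  (slotAntiConcentration_restrict_of_recentredDilation_collar)
open Summit.QuantumFields.YangMills.Theorems.N21LowCentreNonCollapse
  (hmono_of_lowCentre collarImage_mem_relaxedLetter)

variable {X : Type*} [MeasurableSpace X] {κ : Type*} [Fintype κ] [DecidableEq κ]

/-! ## §1 Kept cuts reading no collar coordinate: the per-coordinate odds pass under the cut density -/

section KeptCuts

omit [MeasurableSpace X] [Fintype κ] [DecidableEq κ] in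
/-- the fibrewise cut density `(K p.1).indicator (F p.1) p.2` is the set indicator of `K̂ = {p | p.2 ∈ K p.1}` applied
to `p ↦ F p.1 p.2`. [textbook] -/
theorem fibreIndicator_eq_setIndicator (K : X → Set (κ → ℝ)) (F : X → (κ → ℝ) → ℝ≥0∞) :
    (fun p : X × (κ → ℝ) => (K p.1).indicator (F p.1) p.2)
      = {p : X × (κ → ℝ) | p.2 ∈ K p.1}.indicator fun p => F p.1 p.2 := by
  funext p
  by_cases hp : p.2 ∈ K p.1
  · rw [indicator_of_mem hp, indicator_of_mem (show p ∈ {p : X × (κ → ℝ) | p.2 ∈ K p.1} from hp)]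
  · rw [indicator_of_notMem hp, indicator_of_notMem (show p ∉ {p : X × (κ → ℝ) | p.2 ∈ K p.1} from hp)]

omit [Fintype κ] [DecidableEq κ] in
/-- measurability of the fibrewise cut density from that of `K̂` and `F`. [textbook] -/
theorem measurable_fibreIndicator (K : X → Set (κ → ℝ)) (hK : MeasurableSet {p : X × (κ → ℝ) | p.2 ∈ K p.1})
    {F : X → (κ → ℝ) → ℝ≥0∞} (hF : Measurable fun p : X × (κ → ℝ) => F p.1 p.2) :
    Measurable fun p : X × (κ → ℝ) => (K p.1).indicator (F p.1) p.2 := by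
  rw [fibreIndicator_eq_setIndicator]
  exact hF.indicator hK

omit [Fintype κ] [DecidableEq κ] in
/-- **THE CUT LAW IS THE RESTRICTED LAW.**  `μ.withDensity (𝟙_{K p.1}(p.2)·F) = (μ.withDensity F)|K̂` (part 27
`restrict_withDensity_eq_indicator` BY NAME). [textbook] -/
theorem withDensity_fibreIndicator_eq_restrict (μ : Measure (X × (κ → ℝ))) (K : X → Set (κ → ℝ))
    (hK : MeasurableSet {p : X × (κ → ℝ) | p.2 ∈ K p.1}) (F : X → (κ → ℝ) → ℝ≥0∞) :
    μ.withDensity (fun p : X × (κ → ℝ) => (K p.1).indicator (F p.1) p.2)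
      = (μ.withDensity fun p : X × (κ → ℝ) => F p.1 p.2).restrict {p | p.2 ∈ K p.1} := by
  rw [fibreIndicator_eq_setIndicator, restrict_withDensity_eq_indicator μ hK]

omit [Fintype κ] in
/-- **CONDITIONAL ODDS PASS TO A RESTRICTION READING NO COORDINATE `i`.**  If the per-coordinate odds inequality of
38l §1 (`ν((E ∖ P) ∩ C) ≤ Qᵢ·ν(P ∩ C)` for every measurable `C` not reading coordinate `i`) holds for `ν`, it holds
for `ν|S` whenever `S` is measurable and reads no coordinate `i` (apply it to `C ∩ S`). [textbook] -/
theorem condOdds_restrict_of_notRead (ν : Measure (X × (κ → ℝ))) {i : κ} {P₁ E₁ : Set ℝ}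
    (hP₁ : MeasurableSet P₁) (hE₁ : MeasurableSet E₁) {Qi : ℝ}
    (hodds : ∀ C : Set (X × (κ → ℝ)), MeasurableSet C →
      (∀ (z : X) (w : κ → ℝ) (y : ℝ), (z, update w i y) ∈ C ↔ (z, w) ∈ C) →
      ν (({q | q.2 i ∈ E₁} \ {q | q.2 i ∈ P₁}) ∩ C) ≤ ENNReal.ofReal Qi * ν ({q | q.2 i ∈ P₁} ∩ C))
    {S : Set (X × (κ → ℝ))} (hS : MeasurableSet S)
    (hSi : ∀ (z : X) (w : κ → ℝ) (y : ℝ), (z, update w i y) ∈ S ↔ (z, w) ∈ S)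
    (C : Set (X × (κ → ℝ))) (hC : MeasurableSet C)
    (hCi : ∀ (z : X) (w : κ → ℝ) (y : ℝ), (z, update w i y) ∈ C ↔ (z, w) ∈ C) :
    (ν.restrict S) (({q | q.2 i ∈ E₁} \ {q | q.2 i ∈ P₁}) ∩ C)
      ≤ ENNReal.ofReal Qi * (ν.restrict S) ({q | q.2 i ∈ P₁} ∩ C) := by
  have hu : Measurable fun p : X × (κ → ℝ) => p.2 i := (measurable_pi_apply i).comp measurable_snd
  rw [Measure.restrict_apply (t := ({q : X × (κ → ℝ) | q.2 i ∈ E₁} \ {q | q.2 i ∈ P₁}) ∩ C)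
      (((hu hE₁).diff (hu hP₁)).inter hC),
    Measure.restrict_apply (t := {q : X × (κ → ℝ) | q.2 i ∈ P₁} ∩ C) ((hu hP₁).inter hC), inter_assoc, inter_assoc]
  exact hodds (C ∩ S) (hC.inter hS) fun z w y => by simp only [mem_inter_iff, hCi, hSi]

omit [Fintype κ] in
/-- **★ THE ODDS UNDER KEPT CUTS.**  For kept cuts `K z` whose product set `K̂ = {p | p.2 ∈ K p.1}` is measurable and
reads no coordinate `i`, the per-coordinate odds inequality for the law `μ.withDensity F` gives the same inequality,
same odds, for the cut law `μ.withDensity (𝟙_{K p.1}(p.2)·F)` — the density of parts 30 ∕ 31 (`F = e^{−φ}`), fed by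
the `e^{−φ}` species of 38j ∕ 38k ∕ 38l §2. [textbook] -/
theorem condOdds_keptCuts (μ : Measure (X × (κ → ℝ))) (K : X → Set (κ → ℝ))
    (hK : MeasurableSet {p : X × (κ → ℝ) | p.2 ∈ K p.1}) (F : X → (κ → ℝ) → ℝ≥0∞) {i : κ}
    (hKi : ∀ (z : X) (w : κ → ℝ) (y : ℝ), update w i y ∈ K z ↔ w ∈ K z)
    {P₁ E₁ : Set ℝ} (hP₁ : MeasurableSet P₁) (hE₁ : MeasurableSet E₁) {Qi : ℝ}
    (hodds : ∀ C : Set (X × (κ → ℝ)), MeasurableSet C →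
      (∀ (z : X) (w : κ → ℝ) (y : ℝ), (z, update w i y) ∈ C ↔ (z, w) ∈ C) →
      (μ.withDensity fun p : X × (κ → ℝ) => F p.1 p.2) (({q | q.2 i ∈ E₁} \ {q | q.2 i ∈ P₁}) ∩ C)
        ≤ ENNReal.ofReal Qi * (μ.withDensity fun p : X × (κ → ℝ) => F p.1 p.2) ({q | q.2 i ∈ P₁} ∩ C))
    (C : Set (X × (κ → ℝ))) (hC : MeasurableSet C)
    (hCi : ∀ (z : X) (w : κ → ℝ) (y : ℝ), (z, update w i y) ∈ C ↔ (z, w) ∈ C) :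
    (μ.withDensity fun p : X × (κ → ℝ) => (K p.1).indicator (F p.1) p.2)
        (({q | q.2 i ∈ E₁} \ {q | q.2 i ∈ P₁}) ∩ C)
      ≤ ENNReal.ofReal Qi *
        (μ.withDensity fun p : X × (κ → ℝ) => (K p.1).indicator (F p.1) p.2) ({q | q.2 i ∈ P₁} ∩ C) := by
  rw [withDensity_fibreIndicator_eq_restrict μ K hK F]
  exact condOdds_restrict_of_notRead _ hP₁ hE₁ hodds hK (fun z w y => hKi z w y) C hC hCi

end KeptCuts

/-! ## §2 The envelope clause `henv`, split letterwise (part 30 §C ∕ lens Card 83) -/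

section Letterwise

omit [MeasurableSpace X] [Fintype κ] [DecidableEq κ] in
/-- **THE CORE CLAUSE FROM STAR-CONVEXITY ABOUT THE CENTRE.**  If at every shell point of `C⋆` the core fibre
`{w | U(z, w) < θ ∧ (z, w) ∈ C⋆}` is star-convex about the centre `m z` (core letters are convex and keep the centre;
the sub-level set of a statistic convex along rays from a low-reading centre), then the contraction toward the centre
keeps the core: the image lies in `{U<θ} ∩ C⋆` for every `l ∈ [l₀, 1]`, `l₀ ≥ 0`. [textbook] -/
theorem hcore_of_starConvex (m : X → (κ → ℝ)) (U : X × (κ → ℝ) → ℝ) (Cstar : Set (X × (κ → ℝ))) {θ ρ l₀ : ℝ}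
    (hl₀ : 0 ≤ l₀)
    (hstar : ∀ p : X × (κ → ℝ), θ * (1 - ρ) ≤ U p → U p < θ → p ∈ Cstar →
      StarConvex ℝ (m p.1) {w : κ → ℝ | U (p.1, w) < θ ∧ (p.1, w) ∈ Cstar}) :
    ∀ l ∈ Icc l₀ 1, ∀ p : X × (κ → ℝ), θ * (1 - ρ) ≤ U p → U p < θ → p ∈ Cstar →
      (p.1, m p.1 + l • (p.2 - m p.1)) ∈ {q : X × (κ → ℝ) | U q < θ} ∩ Cstar := by
  intro l hl p h1 h2 h3
  have hw : p.2 ∈ {w : κ → ℝ | U (p.1, w) < θ ∧ (p.1, w) ∈ Cstar} := ⟨h2, h3⟩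
  exact (hstar p h1 h2 h3).add_smul_sub_mem hw (hl₀.trans hl.1) hl.2

omit [MeasurableSpace X] [Fintype κ] [DecidableEq κ] in
/-- **KEPT TWO-SIDED LETTER: the image lands in the relaxed letter** (part 30 `collarImage_mem_relaxedLetter` BY NAME,
`Ioo` form): `w_b ∈ (−θₑ, θₑ)`, `|m_z b| ≤ M_b`, `l ∈ [l₀, 1]` ⇒ `(m z + l(w − m z))_b ∈ (−θₑ′, θₑ′)`,
`θₑ′ = θₑ + (1−l₀)(θₑ + M_b)`. [textbook] -/
theorem letterImage_abs_mem_Ioo (b : κ) (m : X → (κ → ℝ)) {θe Mb l l₀ : ℝ} (hl₀l : l₀ ≤ l) (hl1 : l ≤ 1)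
    (hM : ∀ z, |m z b| ≤ Mb) (z : X) (w : κ → ℝ) (hin : w b ∈ Ioo (-θe) θe) :
    (m z + l • (w - m z)) b ∈ Ioo (-(θe + (1 - l₀) * (θe + Mb))) (θe + (1 - l₀) * (θe + Mb)) := by
  rw [mem_Ioo, ← abs_lt] at hin ⊢
  exact collarImage_mem_relaxedLetter b m hl₀l hl1 hM (z, w) hin

omit [MeasurableSpace X] [Fintype κ] [DecidableEq κ] in
/-- **DROPPED `≥`-CUT: the image stays above the relaxed cut.**  `b ≤ w_i`, `|m_z i| ≤ M_i`, `0 ≤ l`, `l ∈ [l₀, 1]` ⇒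
`b − (1−l₀)(|b| + M_i) ≤ (m z + l(w − m z))_i` (since `(m + l(w−m))_i − b = (1−l)(m_i − b) + l(w_i − b)`). [textbook] -/
theorem letterImage_geCut_mem_Ici (i : κ) (m : X → (κ → ℝ)) {b Mb l l₀ : ℝ} (hl0 : 0 ≤ l) (hl₀l : l₀ ≤ l)
    (hl1 : l ≤ 1) (hM : ∀ z, |m z i| ≤ Mb) (z : X) (w : κ → ℝ) (hin : w i ∈ Ici b) :
    (m z + l • (w - m z)) i ∈ Ici (b - (1 - l₀) * (|b| + Mb)) := by
  rw [mem_Ici] at hin ⊢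
  simp only [Pi.add_apply, Pi.smul_apply, Pi.sub_apply, smul_eq_mul]
  have hMz := hM z
  have hMb0 : 0 ≤ Mb := (abs_nonneg _).trans hMz
  have h1l : 0 ≤ 1 - l := by linarith
  nlinarith [mul_nonneg hl0 (sub_nonneg.2 hin),
    mul_nonneg h1l (show 0 ≤ m z i - b + |m z i| + |b| by linarith [neg_abs_le (m z i), le_abs_self b]),
    mul_nonneg (sub_nonneg.2 hl₀l) (add_nonneg (abs_nonneg b) hMb0), mul_nonneg h1l (sub_nonneg.2 hMz)]

omit [MeasurableSpace X] [Fintype κ] [DecidableEq κ] in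
/-- **★ `henv` LETTERWISE.**  Per-letter image clauses (every support letter `P₁ i` is carried into its envelope letter
`E₁ i` by the contraction toward the centre, `l ∈ [l₀, 1]`) and the core clause (the image stays in `{U<θ} ∩ C⋆`)
give P2's ∕ 38l §3's envelope binder with `Env := (⋂ᵢ {q.2 i ∈ E₁ i}) ∩ ({U<θ} ∩ C⋆)`. [textbook] -/
theorem henv_of_letterwise (m : X → (κ → ℝ)) (U : X × (κ → ℝ) → ℝ) (Cstar : Set (X × (κ → ℝ)))
    (M : Finset κ) (P₁ E₁ : κ → Set ℝ) {θ ρ l₀ : ℝ}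
    (hletter : ∀ i ∈ M, ∀ l ∈ Icc l₀ 1, ∀ (z : X) (w : κ → ℝ),
      w i ∈ P₁ i → (m z + l • (w - m z)) i ∈ E₁ i)
    (hcore : ∀ l ∈ Icc l₀ 1, ∀ p : X × (κ → ℝ), θ * (1 - ρ) ≤ U p → U p < θ → p ∈ Cstar →
      (p.1, m p.1 + l • (p.2 - m p.1)) ∈ {q : X × (κ → ℝ) | U q < θ} ∩ Cstar) :
    ∀ l ∈ Icc l₀ 1, ∀ p : X × (κ → ℝ),
      θ * (1 - ρ) ≤ U p → U p < θ → p ∈ Cstar ∩ ⋂ i ∈ M, {q : X × (κ → ℝ) | q.2 i ∈ P₁ i} →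
        (p.1, m p.1 + l • (p.2 - m p.1))
          ∈ (⋂ i ∈ M, {q : X × (κ → ℝ) | q.2 i ∈ E₁ i}) ∩ ({q | U q < θ} ∩ Cstar) := by
  intro l hl p h1 h2 hp
  refine ⟨mem_iInter₂.2 fun i hi => ?_, hcore l hl p h1 h2 hp.1⟩
  exact hletter i hi l hl p.1 p.2 ((mem_iInter₂.1 hp.2) i hi)

end Letterwise

/-! ## §3 The doubly-discharged junction on the low-centre road -/

section Junction

/-- **★★ THE JUNCTION ON THE LOW-CENTRE ROAD, `hmono` AND `hQ` DISCHARGED.**  Frame of parts 28 ∕ 30 ∕ 31: exterior law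
`ζ` (s-finite), block chart `κ → ℝ`, density `𝟙_{K p.1}(p.2)·e^{−φ_{p.1}(p.2)}` with kept CONVEX cuts `K z` and a CONVEX
block potential `φ_z` on `K z`, a measurable centre `m z ∈ K z` that is LOW seen from the shell ∩ cut
(`φ_z(m z) ≤ φ_z(m z + l₀(w − m z))`, `l₀ = 1 − 1∕(#κ+1)`); cut event `C := C⋆ ∩ ⋂_{i∈M} {q.2 i ∈ P₁ i}` (collar support
letters of any species), envelope `(⋂_{i∈M} {q.2 i ∈ E₁ i}) ∩ ({U<θ} ∩ C⋆)`; `U`, `C⋆` read no collar coordinate;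
per-coordinate conditional odds `Qᵢ` (38l §2 species, under the cuts by §1).  Then P2 holds with `hmono` supplied by
part 30 `hmono_of_lowCentre` and `hQ` by 38l §1 (through 38l §3 BY NAME):
`SlotAntiConcentration (ν|({U<θ} ∩ C)) U θ ρ (3(#κ+1)·∏ᵢ(1+Qᵢ)∕(κ₀(1−ρ)))`.  Displayed binders: `hlow`, `henv`,
`hRT`, `hodds`. [textbook] -/
theorem slotAntiConcentration_restrict_of_lowCentre_collar [Nonempty κ] (ζ : Measure X) [SFinite ζ]
    {m : X → (κ → ℝ)} (hm : Measurable m) (K : X → Set (κ → ℝ)) (φ : X → (κ → ℝ) → ℝ)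
    (hg : Measurable fun p : X × (κ → ℝ) =>
      (K p.1).indicator (fun w => ENNReal.ofReal (Real.exp (-φ p.1 w))) p.2)
    [IsFiniteMeasure ((ζ.prod volume).withDensity fun p : X × (κ → ℝ) =>
      (K p.1).indicator (fun w => ENNReal.ofReal (Real.exp (-φ p.1 w))) p.2)]
    {U : X × (κ → ℝ) → ℝ} (hUm : Measurable U)
    {Cstar : Set (X × (κ → ℝ))} (hCstar : MeasurableSet Cstar)
    (M : Finset κ) (P₁ E₁ : κ → Set ℝ) (hP₁ : ∀ i ∈ M, MeasurableSet (P₁ i))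
    (hE₁ : ∀ i ∈ M, MeasurableSet (E₁ i)) (hPE : ∀ i ∈ M, P₁ i ⊆ E₁ i) (Q : κ → ℝ) (hQ0 : ∀ i ∈ M, 0 ≤ Q i)
    (hodds : ∀ i ∈ M, ∀ C : Set (X × (κ → ℝ)), MeasurableSet C →
      (∀ (z : X) (w : κ → ℝ) (y : ℝ), (z, update w i y) ∈ C ↔ (z, w) ∈ C) →
      ((ζ.prod volume).withDensity fun p : X × (κ → ℝ) =>
          (K p.1).indicator (fun w => ENNReal.ofReal (Real.exp (-φ p.1 w))) p.2)
          (({q | q.2 i ∈ E₁ i} \ {q | q.2 i ∈ P₁ i}) ∩ C)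
        ≤ ENNReal.ofReal (Q i) *
          ((ζ.prod volume).withDensity fun p : X × (κ → ℝ) =>
            (K p.1).indicator (fun w => ENNReal.ofReal (Real.exp (-φ p.1 w))) p.2) ({q | q.2 i ∈ P₁ i} ∩ C))
    (hUi : ∀ i ∈ M, ∀ (z : X) (w : κ → ℝ) (y : ℝ), U (z, update w i y) = U (z, w))
    (hCi : ∀ i ∈ M, ∀ (z : X) (w : κ → ℝ) (y : ℝ), (z, update w i y) ∈ Cstar ↔ (z, w) ∈ Cstar)
    {θ ρ κ₀ : ℝ} (hθ : 0 < θ) (hρ0 : 0 < ρ) (hρ1 : ρ < 1) (hκ : 0 < κ₀)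
    (hK : ∀ z, Convex ℝ (K z)) (hφ : ∀ z, ConvexOn ℝ (K z) (φ z)) (hmK : ∀ z, m z ∈ K z)
    (hlow : ∀ p : X × (κ → ℝ), θ * (1 - ρ) ≤ U p → U p < θ →
      p ∈ Cstar ∩ ⋂ i ∈ M, {q : X × (κ → ℝ) | q.2 i ∈ P₁ i} → p.2 ∈ K p.1 →
        φ p.1 (m p.1) ≤ φ p.1 (m p.1 + (1 - 1 / ((Fintype.card κ : ℝ) + 1)) • (p.2 - m p.1)))
    (henv : ∀ l ∈ Icc (1 - 1 / ((Fintype.card κ : ℝ) + 1)) 1, ∀ p : X × (κ → ℝ),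
      θ * (1 - ρ) ≤ U p → U p < θ → p ∈ Cstar ∩ ⋂ i ∈ M, {q : X × (κ → ℝ) | q.2 i ∈ P₁ i} →
        (p.1, m p.1 + l • (p.2 - m p.1))
          ∈ (⋂ i ∈ M, {q : X × (κ → ℝ) | q.2 i ∈ E₁ i}) ∩ ({q | U q < θ} ∩ Cstar))
    (hRT : ∀ p : X × (κ → ℝ), θ * (1 - ρ) ≤ U p → U p < θ →
      p ∈ Cstar ∩ ⋂ i ∈ M, {q : X × (κ → ℝ) | q.2 i ∈ P₁ i} → ∀ s : ℝ, 1 ≤ s →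
      θ * (1 - ρ) ≤ U (p.1, m p.1 + s • (p.2 - m p.1)) → U (p.1, m p.1 + s • (p.2 - m p.1)) < θ →
        (p.1, m p.1 + s • (p.2 - m p.1)) ∈ Cstar ∩ ⋂ i ∈ M, {q : X × (κ → ℝ) | q.2 i ∈ P₁ i} →
          U p + κ₀ * (θ * (1 - ρ)) * (s - 1) ≤ U (p.1, m p.1 + s • (p.2 - m p.1))) :
    SlotAntiConcentration
      (((ζ.prod volume).withDensity fun p : X × (κ → ℝ) =>
          (K p.1).indicator (fun w => ENNReal.ofReal (Real.exp (-φ p.1 w))) p.2).restrict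
        ({p | U p < θ} ∩ (Cstar ∩ ⋂ i ∈ M, {q : X × (κ → ℝ) | q.2 i ∈ P₁ i}))) U θ ρ
      (3 * ((Fintype.card κ : ℝ) + 1) * (∏ i ∈ M, (1 + Q i)) / (κ₀ * (1 - ρ))) := by
  have hl₀ : 0 < 1 - 1 / ((Fintype.card κ : ℝ) + 1) := by
    have hcard : (1 : ℝ) ≤ (Fintype.card κ : ℝ) := by exact_mod_cast Fintype.card_pos
    have : 1 / ((Fintype.card κ : ℝ) + 1) < 1 := by
      rw [div_lt_one (by positivity)]
      linarith
    linarith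
  exact slotAntiConcentration_restrict_of_recentredDilation_collar ζ hm hg hUm hCstar M P₁ E₁ hP₁ hE₁ hPE Q hQ0
    hodds hUi hCi hθ hρ0 hρ1 hκ henv
    (hmono_of_lowCentre K φ m U (Cstar ∩ ⋂ i ∈ M, {q : X × (κ → ℝ) | q.2 i ∈ P₁ i}) hK hφ hmK hl₀ hlow) hRT

/-- **★★★ THE JUNCTION ON THE LOW-CENTRE ROAD WITH THE ENVELOPE SPLIT LETTERWISE** — P2 with `hmono` (part 30),
`hQ` (38l §1) AND `henv` (§2) discharged.  Displayed binders: the low-centre inequality `hlow`, radial transversality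
`hRT`, the per-letter image clauses `hletter` (§2's two species produce them from a bound on the centre's collar
coordinates), the core clause `hcore` (§2 `hcore_of_starConvex`), and the per-coordinate odds `hodds` (38l §2 under the
cuts by §1). [textbook] -/
theorem slotAntiConcentration_restrict_of_lowCentre_letterwise [Nonempty κ] (ζ : Measure X) [SFinite ζ]
    {m : X → (κ → ℝ)} (hm : Measurable m) (K : X → Set (κ → ℝ)) (φ : X → (κ → ℝ) → ℝ)
    (hg : Measurable fun p : X × (κ → ℝ) =>
      (K p.1).indicator (fun w => ENNReal.ofReal (Real.exp (-φ p.1 w))) p.2)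
    [IsFiniteMeasure ((ζ.prod volume).withDensity fun p : X × (κ → ℝ) =>
      (K p.1).indicator (fun w => ENNReal.ofReal (Real.exp (-φ p.1 w))) p.2)]
    {U : X × (κ → ℝ) → ℝ} (hUm : Measurable U)
    {Cstar : Set (X × (κ → ℝ))} (hCstar : MeasurableSet Cstar)
    (M : Finset κ) (P₁ E₁ : κ → Set ℝ) (hP₁ : ∀ i ∈ M, MeasurableSet (P₁ i))
    (hE₁ : ∀ i ∈ M, MeasurableSet (E₁ i)) (hPE : ∀ i ∈ M, P₁ i ⊆ E₁ i) (Q : κ → ℝ) (hQ0 : ∀ i ∈ M, 0 ≤ Q i)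
    (hodds : ∀ i ∈ M, ∀ C : Set (X × (κ → ℝ)), MeasurableSet C →
      (∀ (z : X) (w : κ → ℝ) (y : ℝ), (z, update w i y) ∈ C ↔ (z, w) ∈ C) →
      ((ζ.prod volume).withDensity fun p : X × (κ → ℝ) =>
          (K p.1).indicator (fun w => ENNReal.ofReal (Real.exp (-φ p.1 w))) p.2)
          (({q | q.2 i ∈ E₁ i} \ {q | q.2 i ∈ P₁ i}) ∩ C)
        ≤ ENNReal.ofReal (Q i) *
          ((ζ.prod volume).withDensity fun p : X × (κ → ℝ) =>
            (K p.1).indicator (fun w => ENNReal.ofReal (Real.exp (-φ p.1 w))) p.2) ({q | q.2 i ∈ P₁ i} ∩ C))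
    (hUi : ∀ i ∈ M, ∀ (z : X) (w : κ → ℝ) (y : ℝ), U (z, update w i y) = U (z, w))
    (hCi : ∀ i ∈ M, ∀ (z : X) (w : κ → ℝ) (y : ℝ), (z, update w i y) ∈ Cstar ↔ (z, w) ∈ Cstar)
    {θ ρ κ₀ : ℝ} (hθ : 0 < θ) (hρ0 : 0 < ρ) (hρ1 : ρ < 1) (hκ : 0 < κ₀)
    (hK : ∀ z, Convex ℝ (K z)) (hφ : ∀ z, ConvexOn ℝ (K z) (φ z)) (hmK : ∀ z, m z ∈ K z)
    (hlow : ∀ p : X × (κ → ℝ), θ * (1 - ρ) ≤ U p → U p < θ →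
      p ∈ Cstar ∩ ⋂ i ∈ M, {q : X × (κ → ℝ) | q.2 i ∈ P₁ i} → p.2 ∈ K p.1 →
        φ p.1 (m p.1) ≤ φ p.1 (m p.1 + (1 - 1 / ((Fintype.card κ : ℝ) + 1)) • (p.2 - m p.1)))
    (hletter : ∀ i ∈ M, ∀ l ∈ Icc (1 - 1 / ((Fintype.card κ : ℝ) + 1)) 1, ∀ (z : X) (w : κ → ℝ),
      w i ∈ P₁ i → (m z + l • (w - m z)) i ∈ E₁ i)
    (hcore : ∀ l ∈ Icc (1 - 1 / ((Fintype.card κ : ℝ) + 1)) 1, ∀ p : X × (κ → ℝ),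
      θ * (1 - ρ) ≤ U p → U p < θ → p ∈ Cstar →
        (p.1, m p.1 + l • (p.2 - m p.1)) ∈ {q : X × (κ → ℝ) | U q < θ} ∩ Cstar)
    (hRT : ∀ p : X × (κ → ℝ), θ * (1 - ρ) ≤ U p → U p < θ →
      p ∈ Cstar ∩ ⋂ i ∈ M, {q : X × (κ → ℝ) | q.2 i ∈ P₁ i} → ∀ s : ℝ, 1 ≤ s →
      θ * (1 - ρ) ≤ U (p.1, m p.1 + s • (p.2 - m p.1)) → U (p.1, m p.1 + s • (p.2 - m p.1)) < θ →
        (p.1, m p.1 + s • (p.2 - m p.1)) ∈ Cstar ∩ ⋂ i ∈ M, {q : X × (κ → ℝ) | q.2 i ∈ P₁ i} →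
          U p + κ₀ * (θ * (1 - ρ)) * (s - 1) ≤ U (p.1, m p.1 + s • (p.2 - m p.1))) :
    SlotAntiConcentration
      (((ζ.prod volume).withDensity fun p : X × (κ → ℝ) =>
          (K p.1).indicator (fun w => ENNReal.ofReal (Real.exp (-φ p.1 w))) p.2).restrict
        ({p | U p < θ} ∩ (Cstar ∩ ⋂ i ∈ M, {q : X × (κ → ℝ) | q.2 i ∈ P₁ i}))) U θ ρ
      (3 * ((Fintype.card κ : ℝ) + 1) * (∏ i ∈ M, (1 + Q i)) / (κ₀ * (1 - ρ))) :=
  slotAntiConcentration_restrict_of_lowCentre_collar ζ hm K φ hg hUm hCstar M P₁ E₁ hP₁ hE₁ hPE Q hQ0 hodds hUi hCi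
    hθ hρ0 hρ1 hκ hK hφ hmK hlow (henv_of_letterwise m U Cstar M P₁ E₁ hletter hcore) hRT

end Junction

end Summit.QuantumFields.YangMills.Theorems.N21CollarJunctionLowCentre
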